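import Summits.CriticalPhenomena.PercolationContinuityZ3.Theorems.PercAnnulusCrossingIICBallsSandwich
import HarnessLib

/-!
# Dimension relations for Kesten's IIC, I: `d_f ≥ d_ℓ · d_min` almost surely — `γ⁻·α⁻ ≤ β⁻`, `γ⁻·α⁺ ≤ β⁺` (lane RSW3, p1 gen 15)

builds on p205010 (kernel theorem, internal audit signed; external expert review pending) — through `θ(p_c) = 0` in the imported gen 14
exponent files (`criticalProbI` statements); the `ℤ²` statement is unconditional.

Seat `prim-rsw3-p1` (gen 15); memo `run/shared/lean/prim/rsw3/P1-QM.md` §28.  Helper file for the crux `stmt-CriticalPhenomena-4575`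
chain; no definitions, no sorries.  gen 14 made the exponents of Kesten's IIC deterministic: `α^±` (chemical distance `D_n` from the root to
`Λ(n)ᶜ`, "`d_min`"), `β^±` (volume `V_n` of `C(0) ∩ Λ(n)`, "`d_f`"), `γ^±` (intrinsic-ball volume `I_r`, "`d_ℓ`"), with `1 ≤ α⁻ ≤ α⁺ ≤ β⁺ ≤ d`,
`1 ≤ γ⁻ ≤ γ⁺ ≤ β⁺`.  The physics literature relates them by `d_f = d_ℓ · d_min` (Havlin–Ben-Avraham 1987, §3): the Euclidean ball of radius
`n` is the chemical ball of radius `≈ n^{d_min}`, whose mass is `≈ (n^{d_min})^{d_ℓ}`.  The rigorous content available without existence of the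
exponents is ONE-SIDED and follows from the inner half of gen 15's balls sandwich, `I_{D_n - 1} ≤ V_n` (`…IICBallsSandwich`):
`log V_n / log(n+2) ≥ [log I_{D_n-1} / log(D_n+1)] · [log D_n / log(n+2)]`, and `D_n - 1 → ∞`.  Hence:

* generic `[0,∞]`-valued sequence algebra (no `CountableInterFilter` on `atTop`, so Mathlib's `ENNReal.limsup_mul_le` is unavailable and the
  needed halves are proved by hand): `liminf_mul_limsup_le_limsup_mul`, `liminf_mul_liminf_le_liminf_mul`;
* `ofReal_log_div_mul_le` — the pointwise inequality above in `[0,∞]`;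
* **`iicMeasure_dimension_relations_lower_criticalProbI`** — at `p_c(ℤ^d)`, `d ≥ 2`, under (A2)□ at aspect `(s,L)`, `2 ≤ s ≤ L`, for every measure
  `ν` with Kesten's IIC limit property: the deterministic exponents satisfy, besides gen 14's relations, **`γ⁻ · α⁻ ≤ β⁻` and `γ⁻ · α⁺ ≤ β⁺`**
  (so `β⁻ ≥ γ⁻ α⁻ ≥ 1` recovers and couples the two trivial lower bounds, and `α⁺ ≤ β⁺/γ⁻`: a long chemical exit distance forces a fat cluster);
* **`iicMeasure_dimension_relations_lower_Z2`** — the same for Kesten's planar IIC, unconditionally.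

The UPPER halves `β⁺ ≤ γ⁺·μ⁺`, `β⁻ ≤ γ⁺·μ⁻` need the outer ball `C(0) ∩ Λ(n) ⊆ B_ω(0, M_n)` and the deterministic eccentricity exponents `μ^±`
(gen 15, `…IICEccentricity`); the mass-dimension chain `β⁻ + ρ⁺ ≤ d ≤ β⁺ + ρ⁺`, `β⁺ + ρ⁻ ≤ d` against the one-arm exponents is
`…IICMassDimension`.
References: S. Havlin, D. Ben-Avraham, Adv. Phys. 36 (1987), §3; H. Kesten, PTRF 73 (1986), Thm. (8); H.-O. Georgii (2011), Prop. 7.9.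
-/

noncomputable section

namespace Summit.CriticalPhenomena.PercolationContinuityZ3.Theorems.Crossing

open MeasureTheory Filter Topology Literature.Probability.Percolation Literature.Probability.LatticeModels
open Literature.Probability.Percolation.DCT16 Literature.Probability.Percolation.DKT20
open Summit.CriticalPhenomena.PercolationContinuityZ3.Theorems.SurfaceTension
open scoped Literature.Probability.Percolation ENNReal symmDiff

variable {d : ℕ}

/-! ## Products of `liminf`/`limsup` in `[0,∞]` along `atTop` -/

/-- `liminf u · limsup v ≤ limsup (u·v)` for `[0,∞]`-valued sequences. [folklore] -/
theorem liminf_mul_limsup_le_limsup_mul (u v : ℕ → ℝ≥0∞) :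
    liminf u atTop * limsup v atTop ≤ limsup (fun n => u n * v n) atTop := by
  refine ENNReal.mul_le_of_forall_lt fun a ha b hb => ?_
  have hu : ∀ᶠ n in atTop, a < u n := eventually_lt_of_lt_liminf ha
  have hv : ∃ᶠ n in atTop, b < v n := frequently_lt_of_lt_limsup (by isBoundedDefault) hb
  refine le_limsup_of_frequently_le' ((hv.and_eventually hu).mono fun n hn => ?_)
  exact mul_le_mul' hn.2.le hn.1.le

/-- `liminf u · liminf v ≤ liminf (u·v)` for `[0,∞]`-valued sequences. [folklore] -/
theorem liminf_mul_liminf_le_liminf_mul (u v : ℕ → ℝ≥0∞) :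
    liminf u atTop * liminf v atTop ≤ liminf (fun n => u n * v n) atTop := by
  refine ENNReal.mul_le_of_forall_lt fun a ha b hb => ?_
  have hu : ∀ᶠ n in atTop, a < u n := eventually_lt_of_lt_liminf ha
  have hv : ∀ᶠ n in atTop, b < v n := eventually_lt_of_lt_liminf hb
  exact le_liminf_of_le (by isBoundedDefault) ((hu.and hv).mono fun n hn => mul_le_mul' hn.1.le hn.2.le)

/-! ## The pointwise inequality from the inner ball -/

/-- If `1 ≤ I ≤ V` and `1 ≤ D` then `[log I/log(D+1)] · [log D/log(n+2)] ≤ log V/log(n+2)` in `[0,∞]` (`log D ≤ log(D+1)`). [folklore] -/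
theorem ofReal_log_div_mul_le (I V D n : ℕ) (hI : 1 ≤ I) (hIV : I ≤ V) (hD : 1 ≤ D) :
    ENNReal.ofReal (Real.log (I : ℝ) / Real.log ((D : ℝ) + 1)) * ENNReal.ofReal (Real.log (D : ℝ) / Real.log ((n : ℝ) + 2)) ≤
      ENNReal.ofReal (Real.log (V : ℝ) / Real.log ((n : ℝ) + 2)) := by
  have hI' : (1 : ℝ) ≤ I := by exact_mod_cast hI
  have hD' : (1 : ℝ) ≤ D := by exact_mod_cast hD
  have hlogI : 0 ≤ Real.log (I : ℝ) := Real.log_nonneg hI'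
  have hlogD : 0 ≤ Real.log (D : ℝ) := Real.log_nonneg hD'
  have hlogD1 : 0 < Real.log ((D : ℝ) + 1) := Real.log_pos (by linarith)
  have hn2 : 0 < Real.log ((n : ℝ) + 2) := Real.log_pos (by linarith [(Nat.cast_nonneg n : (0 : ℝ) ≤ n)])
  rw [← ENNReal.ofReal_mul (div_nonneg hlogI hlogD1.le)]
  refine ENNReal.ofReal_le_ofReal ?_
  have hDD1 : Real.log (D : ℝ) ≤ Real.log ((D : ℝ) + 1) := Real.log_le_log (by linarith) (by linarith)
  have hIV' : Real.log (I : ℝ) ≤ Real.log (V : ℝ) := Real.log_le_log (by linarith) (by exact_mod_cast hIV)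
  calc Real.log (I : ℝ) / Real.log ((D : ℝ) + 1) * (Real.log (D : ℝ) / Real.log ((n : ℝ) + 2))
      ≤ Real.log (I : ℝ) / Real.log ((D : ℝ) + 1) * (Real.log ((D : ℝ) + 1) / Real.log ((n : ℝ) + 2)) :=
        mul_le_mul_of_nonneg_left (div_le_div_of_nonneg_right hDD1 hn2.le) (div_nonneg hlogI hlogD1.le)
    _ = Real.log (I : ℝ) / Real.log ((n : ℝ) + 2) := by field_simp
    _ ≤ Real.log (V : ℝ) / Real.log ((n : ℝ) + 2) := div_le_div_of_nonneg_right hIV' hn2.le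

/-! ## `γ⁻·α⁻ ≤ β⁻` and `γ⁻·α⁺ ≤ β⁺` -/

open Classical in
/-- **`d_f ≥ d_ℓ · d_min` FOR KESTEN'S IIC AT `p_c(ℤ^d)`, IN THE TWO-SIDED A.S. FORM `γ⁻·α⁻ ≤ β⁻`, `γ⁻·α⁺ ≤ β⁺`** (`d ≥ 2`, (A2)□ at aspect
`(s,L)`, `2 ≤ s ≤ L`; `ν` any measure with Kesten's IIC limit property): there are deterministic `α^±, β^±, γ^± ∈ [0,∞]` with
`1 ≤ α⁻ ≤ α⁺ ≤ β⁺ ≤ d`, `α⁻ ≤ β⁻ ≤ β⁺`, `1 ≤ γ⁻ ≤ γ⁺ ≤ β⁺` (gen 14) AND `γ⁻·α⁻ ≤ β⁻`, `γ⁻·α⁺ ≤ β⁺`, realised `ν`-a.s. as the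
`liminf/limsup` of `log D_n/log(n+2)`, `log V_n/log(n+2)`, `log I_r/log(r+2)` (inner ball `I_{D_n-1} ≤ V_n`, `D_n - 1 → ∞`).
[cite: HavlinBenAvraham1987, §3] [cite: Kesten1986, Thm. (8)] [cite: Georgii2011, Prop. 7.9] -/
theorem iicMeasure_dimension_relations_lower_criticalProbI (hd : 2 ≤ d) {s L : ℕ} (hs : 2 ≤ s) (hsL : s ≤ L) {ϰ : ℝ} (hϰ : 0 < ϰ)
    (hA2 : SetToSetQuasiMultAspectAt d (criticalProbI d) s L ϰ)
    {ν : Measure (BondConfig (Site d))} [IsProbabilityMeasure ν]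
    (hν : ∀ (F : Finset (Sym2 (Site d))) (E : Set (BondConfig (Site d))), MeasurableSet E → DeterminedBy E ↑F →
      Tendsto (fun n : ℕ => (bondPercolation (zdGraph d) (criticalProbI d)).real (E ∩ siteToBoundary d n) /
        oneArmProb d (criticalProbI d) n) atTop (𝓝 (ν.real E))) :
    ∃ αl αu βl βu γl γu : ℝ≥0∞, (1 ≤ αl ∧ αl ≤ αu ∧ αu ≤ βu ∧ βu ≤ d ∧ αl ≤ βl ∧ βl ≤ βu ∧ 1 ≤ γl ∧ γl ≤ γu ∧ γu ≤ βu) ∧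
      (γl * αl ≤ βl ∧ γl * αu ≤ βu) ∧
      ∀ᵐ ω ∂ν,
      liminf (fun n => ENNReal.ofReal
        (Real.log (((⨅ v : {v : Site d // v ∉ box d n}, (openGraph ω).edist (0 : Site d) v.1).toNat : ℕ) : ℝ) /
          Real.log ((n : ℝ) + 2))) atTop = αl ∧
      limsup (fun n => ENNReal.ofReal
        (Real.log (((⨅ v : {v : Site d // v ∉ box d n}, (openGraph ω).edist (0 : Site d) v.1).toNat : ℕ) : ℝ) /
          Real.log ((n : ℝ) + 2))) atTop = αu ∧
      liminf (fun n => ENNReal.ofReal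
        (Real.log ((((box d n).filter fun z => ω ∈ (openConn (0 : Site d) z : Set (BondConfig (Site d)))).card : ℕ) : ℝ) /
          Real.log ((n : ℝ) + 2))) atTop = βl ∧
      limsup (fun n => ENNReal.ofReal
        (Real.log ((((box d n).filter fun z => ω ∈ (openConn (0 : Site d) z : Set (BondConfig (Site d)))).card : ℕ) : ℝ) /
          Real.log ((n : ℝ) + 2))) atTop = βu ∧
      liminf (fun r => ENNReal.ofReal (Real.log
        ((Set.ncard {z : Site d | z ∈ box d r ∧ (openGraph ω).edist (0 : Site d) z ≤ (r : ℕ)} : ℕ) : ℝ) /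
          Real.log ((r : ℝ) + 2))) atTop = γl ∧
      limsup (fun r => ENNReal.ofReal (Real.log
        ((Set.ncard {z : Site d | z ∈ box d r ∧ (openGraph ω).edist (0 : Site d) z ≤ (r : ℕ)} : ℕ) : ℝ) /
          Real.log ((r : ℝ) + 2))) atTop = γu := by
  classical
  have hd1 : 1 ≤ d := by omega
  have hpc : 0 < ((criticalProbI d : unitInterval) : ℝ) := by rw [coe_criticalProbI]; exact criticalProb_zd_pos d hd1
  obtain ⟨αl, αu, βl, βu, γl, γu, hrel, hae⟩ := iicMeasure_exponents_master_criticalProbI hd hs hsL hϰ hA2 hν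
  refine ⟨αl, αu, βl, βu, γl, γu, hrel, ?_, hae⟩
  -- a good configuration
  obtain ⟨ω, hω, hsand, hib, hDV⟩ := (hae.and ((iicMeasure_ae_balls_sandwich hd1 (criticalProbI d) hpc hν).and
    ((iicMeasure_ae_intrinsic_bounds hd1 (criticalProbI d) hpc hν).and
      (iicMeasure_ae_chemical_le_volume hd1 (criticalProbI d) hpc hν)))).exists
  obtain ⟨hαl, hαu, hβl, hβu, hγl, hγu⟩ := hω
  -- notation: `D n`, `V n`, `I r`, the radius `r n = D n - 1`
  set D : ℕ → ℕ := fun n => (⨅ v : {v : Site d // v ∉ box d n}, (openGraph ω).edist (0 : Site d) v.1).toNat with hD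
  set V : ℕ → ℕ := fun n => ((box d n).filter fun z => ω ∈ (openConn (0 : Site d) z : Set (BondConfig (Site d)))).card with hV
  set I : ℕ → ℕ := fun r => Set.ncard {z : Site d | z ∈ box d r ∧ (openGraph ω).edist (0 : Site d) z ≤ (r : ℕ)} with hI
  set g : ℕ → ℝ≥0∞ := fun r => ENNReal.ofReal (Real.log ((I r : ℕ) : ℝ) / Real.log ((r : ℝ) + 2)) with hg
  set a : ℕ → ℝ≥0∞ := fun n => ENNReal.ofReal (Real.log ((D n : ℕ) : ℝ) / Real.log ((n : ℝ) + 2)) with ha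
  set x : ℕ → ℝ≥0∞ := fun n => ENNReal.ofReal (Real.log ((V n : ℕ) : ℝ) / Real.log ((n : ℝ) + 2)) with hx
  set r : ℕ → ℕ := fun n => D n - 1 with hr
  -- `r n ≥ n`, so `r → ∞`
  have hrn : ∀ n, n ≤ r n := fun n => (hsand n).2.2.1
  have hrt : Tendsto r atTop atTop := tendsto_atTop_mono hrn tendsto_id
  -- `γ⁻ ≤ liminf (g ∘ r)`
  have hγ : γl ≤ liminf (fun n => g (r n)) atTop := by
    rw [← hγl]
    exact hrt.liminf_le_liminf_comp (u := g)
  -- pointwise: `g (r n) * a n ≤ x n`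
  have hpt : ∀ n, g (r n) * a n ≤ x n := by
    intro n
    have h1 : 1 ≤ D n := le_trans (Nat.succ_le_succ (Nat.zero_le n)) (hDV n).1
    have hcast : ((r n : ℕ) : ℝ) + 2 = ((D n : ℕ) : ℝ) + 1 := by
      have : r n + 1 = D n := by simp only [hr]; omega
      have h' : ((r n : ℕ) : ℝ) + 1 = ((D n : ℕ) : ℝ) := by exact_mod_cast this
      linarith
    simp only [hg, ha, hx]
    rw [hcast]
    exact ofReal_log_div_mul_le (I (r n)) (V n) (D n) n ((hib (r n)).1.trans' (Nat.le_add_left 1 _)) (hsand n).1 h1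
  constructor
  · -- `γ⁻ · α⁻ ≤ β⁻`
    rw [← hαl, ← hβl]
    calc γl * liminf a atTop ≤ liminf (fun n => g (r n)) atTop * liminf a atTop := mul_le_mul' hγ le_rfl
      _ ≤ liminf (fun n => g (r n) * a n) atTop := liminf_mul_liminf_le_liminf_mul _ _
      _ ≤ liminf x atTop := liminf_le_liminf (Filter.Eventually.of_forall hpt)
  · -- `γ⁻ · α⁺ ≤ β⁺`
    rw [← hαu, ← hβu]
    calc γl * limsup a atTop ≤ liminf (fun n => g (r n)) atTop * limsup a atTop := mul_le_mul' hγ le_rfl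
      _ ≤ limsup (fun n => g (r n) * a n) atTop := liminf_mul_limsup_le_limsup_mul _ _
      _ ≤ limsup x atTop := limsup_le_limsup (Filter.Eventually.of_forall hpt)

open Classical in
/-- **`d_f ≥ d_ℓ · d_min` FOR KESTEN'S PLANAR IIC, UNCONDITIONALLY**: deterministic exponents with `1 ≤ α⁻ ≤ α⁺ ≤ β⁺`, `α⁻ ≤ β⁻ ≤ β⁺`,
`1 ≤ γ⁻ ≤ γ⁺ ≤ β⁺`, `3/2 ≤ β⁺ ≤ 2 - 2^{-158} < 2`, and `γ⁻·α⁻ ≤ β⁻`, `γ⁻·α⁺ ≤ β⁺`, realised `ν`-a.s., for every measure `ν` with Kesten's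
IIC limit property at `p_c(ℤ²) = 1/2`. [cite: HavlinBenAvraham1987, §3] [cite: Kesten1986, Thm. (3), (8)] [cite: Georgii2011, Prop. 7.9] -/
theorem iicMeasure_dimension_relations_lower_Z2 {ν : Measure (BondConfig (Site 2))} [IsProbabilityMeasure ν]
    (hν : ∀ (F : Finset (Sym2 (Site 2))) (E : Set (BondConfig (Site 2))), MeasurableSet E → DeterminedBy E ↑F →
      Tendsto (fun n : ℕ => (bondPercolation (zdGraph 2) (criticalProbI 2)).real (E ∩ siteToBoundary 2 n) /
        oneArmProb 2 (criticalProbI 2) n) atTop (𝓝 (ν.real E))) :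
    ∃ αl αu βl βu γl γu : ℝ≥0∞, (1 ≤ αl ∧ αl ≤ αu ∧ αu ≤ βu ∧ αl ≤ βl ∧ βl ≤ βu ∧ 1 ≤ γl ∧ γl ≤ γu ∧ γu ≤ βu ∧
        ENNReal.ofReal (3 / 2) ≤ βu ∧ βu ≤ ENNReal.ofReal (2 - (2 : ℝ)⁻¹ ^ 158) ∧ βu < 2) ∧
      (γl * αl ≤ βl ∧ γl * αu ≤ βu) ∧
      ∀ᵐ ω ∂ν,
      liminf (fun n => ENNReal.ofReal
        (Real.log (((⨅ v : {v : Site 2 // v ∉ box 2 n}, (openGraph ω).edist (0 : Site 2) v.1).toNat : ℕ) : ℝ) /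
          Real.log ((n : ℝ) + 2))) atTop = αl ∧
      limsup (fun n => ENNReal.ofReal
        (Real.log (((⨅ v : {v : Site 2 // v ∉ box 2 n}, (openGraph ω).edist (0 : Site 2) v.1).toNat : ℕ) : ℝ) /
          Real.log ((n : ℝ) + 2))) atTop = αu ∧
      liminf (fun n => ENNReal.ofReal
        (Real.log ((((box 2 n).filter fun z => ω ∈ (openConn (0 : Site 2) z : Set (BondConfig (Site 2)))).card : ℕ) : ℝ) /
          Real.log ((n : ℝ) + 2))) atTop = βl ∧
      limsup (fun n => ENNReal.ofReal
        (Real.log ((((box 2 n).filter fun z => ω ∈ (openConn (0 : Site 2) z : Set (BondConfig (Site 2)))).card : ℕ) : ℝ) /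
          Real.log ((n : ℝ) + 2))) atTop = βu ∧
      liminf (fun r => ENNReal.ofReal (Real.log
        ((Set.ncard {z : Site 2 | z ∈ box 2 r ∧ (openGraph ω).edist (0 : Site 2) z ≤ (r : ℕ)} : ℕ) : ℝ) /
          Real.log ((r : ℝ) + 2))) atTop = γl ∧
      limsup (fun r => ENNReal.ofReal (Real.log
        ((Set.ncard {z : Site 2 | z ∈ box 2 r ∧ (openGraph ω).edist (0 : Site 2) z ≤ (r : ℕ)} : ℕ) : ℝ) /
          Real.log ((r : ℝ) + 2))) atTop = γu := by
  classical
  obtain ⟨ϰ, hϰ, hA2⟩ := exists_setToSetQuasiMultAspectAt_two_of_criticalProbI_le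
  obtain ⟨αl, αu, βl, βu, γl, γu, hrel, hprod, hae⟩ :=
    iicMeasure_dimension_relations_lower_criticalProbI (d := 2) le_rfl (by norm_num) (by norm_num) hϰ (hA2 _ le_rfl) hν
  obtain ⟨αl', αu', βl', βu', γl', γu', hrel3, hae3⟩ := iicMeasure_exponents_master3_Z2 hν
  obtain ⟨ω, hω1, hω2⟩ := (hae.and hae3).exists
  have hβ : βu' = βu := by rw [← hω2.2.2.2.1, hω1.2.2.2.1]
  subst hβ
  exact ⟨αl, αu, βl, βu', γl, γu, ⟨hrel.1, hrel.2.1, hrel.2.2.1, hrel.2.2.2.2.1, hrel.2.2.2.2.2.1, hrel.2.2.2.2.2.2.1,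
    hrel.2.2.2.2.2.2.2.1, hrel.2.2.2.2.2.2.2.2, hrel3.2.2.2.2.2.2.2.2.1, hrel3.2.2.2.2.2.2.2.2.2.1, hrel3.2.2.2.2.2.2.2.2.2.2⟩, hprod, hae⟩

end Summit.CriticalPhenomena.PercolationContinuityZ3.Theorems.Crossing

end
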